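import Literature.AnabelianGeometry.SemiGraphs.TemperedPiBranchStabilizerImage
import Literature.AnabelianGeometry.SemiGraphs.TemperedPiPointSeqThroughVertex
import Literature.AnabelianGeometry.SemiGraphs.TemperedPiFibreFaithful
import Literature.GroupTheory.EstrangementDepth
import HarnessLib

/-!
# [SemiAnbd] Thm 3.7 (iii) beyond finite `𝔾`: ESTRANGEMENT IN DEPTH at the canonical tower —
# eventually no fixed edge pair over two DISTINCT base branches at a vertex of finite valence

Mochizuki, *Semi-graphs of anabelioids*, Publ. RIMS **42** (2006), §2 Def. 2.4 (iv) p. 26 (totally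
estranged) and §3 Theorem 3.7 (iii), proof p. 41, third paragraph, with the author's *Comments* (2020)
(6)(b) ("`H` … is … contained, for two distinct branches `b, b'` … in the intersection of the images of
`π̂₁(𝒢_e)`, `π̂₁(𝒢_{e'})` … since `𝒢` is totally estranged, … `H` is trivial")
[cite: MochizukiSemiAnbd2006, Thm 3.7(iii) p.41].

PROOF-ONLY (cell abc-iut, layer L3, GAP row G-t6g3-2b «no escape», binder `hbdd`; seat abc-iut-w6-d062,
brick B1b(i) of the desk memo HOME/staging/w6/w6-d062/HBDD-LOCFIN-memo.md §2 «depth lemma», the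
DISTINCT-BASE-BRANCH half).  At the canonical tower `D := 𝒢.galoisLevelData h36` of the constructed chart
and for a base vertex `w` with FINITELY MANY branches: for every element `c ≠ 1` of `π₁^temp(𝒢)` there is
a level `k` such that at every level `k' ≥ k`, at every tree vertex `v` of `𝔾̃_{k'}` over `w`, `c` does NOT
fix two tree edges whose branches at `v` lie over two DISTINCT branches of `𝔾` at `w`
(`eventually_not_fixed_pair_of_ne_base`).  This is a QUANTITATIVE, single-element, finite-level form of the
(I4′)_cpt kill: no compactness of a subgroup, no compatible SYSTEM of fixed branch pairs is needed —
only compactness of `Π_w`: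

* the level kernels `N n := {h ∈ Π_w | h fixes every point of (S n)_w}` (built inside the proof; lemmas `levelKernel_*` over any family with the membership law): open (finite
  fibres), normal, antitone (fibre-surjective tower maps), separating ((I0v) `galoisLevelData_faithfulV`),
  and CONTAINING the stabiliser of any point of `(𝒢_{∞,n})_w` (Galois levels: all point stabilisers of
  `(S n)_w` coincide; graph-covering `𝒢_{∞,n} → S n`);
* abc-iut-L3-t11's single-level branch dictionary `PointSeq.exists_conj_brHom_pair_of_edgeMap_eq`
  (TemperedPiBranchStabilizerImage.lean): `c` fixing the two edges at `P.vertex k'` gives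
  `ρ_{k'}(c) = σ^{h₁} = σ^{h₂}` with `hᵢ = fᵢ bᵢ*(kᵢ) fᵢ⁻¹` and `h₁⁻¹h₂ ∈ Stab(P.pt k') ≤ N k'`, i.e.
  `f₁⁻¹h₁f₁ ∈ Π_{b₁} ∩ (m Π_{b₂} m⁻¹)·N k'`, `m = f₁⁻¹f₂`;
* the Mathlib-only depth core `EstrangementDepth.exists_level_mul_inter_mul_subset` (this seat,
  p441748/p442464) with `M = Π_w` (total estrangement, distinct branches: `IsEstrangedEdge` clause 2) then
  puts `h₁` into `N j₀`, whence `ρ_{j₀}(c) = σ^{h₁}_{j₀} = 1` — against the choice of `j₀`.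

The SAME-base-branch half (two tree edges over one branch `b` of `𝔾`, distinct images at a reference
level) needs the LINKED form of the dictionary (`β = brOf b (f⁻¹·t)`, two levels) and is brick B1b(ii) of
the memo; together they give the binder (LE_C,w) of `hbdd_of_localLevelEstranged`
(`TemperedHbddOfLocalLevelEstrangement.lean`).  Nothing here bears on [IUTchIII] Cor. 3.12; typed ≠ proved
elsewhere.
-/

namespace Literature.AnabelianGeometry.SemiGraphs

namespace ProfiniteSemiGraph

namespace GaloisLevelData

open CategoryTheory Topology
open scoped Pointwise
open Literature.AlgebraicGeometry.Frobenioids.QuasiTemperoid.BTempConnected (ρ_one_apply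
  ρ_mul_apply ρ_inv_apply)

universe u

variable {𝒢 : ProfiniteSemiGraph.{u}} (D : GaloisLevelData 𝒢) (h𝒢 : 𝒢.IsCountable)
  (w : 𝒢.graph.Vertex)

/-! ### Level kernels of `Π_w` on the finite Galois levels (any family with the membership law) -/

/-- A family of subgroups `N n ≤ Π_w` *is the family of level kernels at `w`* when membership in `N n` means
fixing every point of the `w`-fibre of the finite Galois level `S n` (stated as a hypothesis `hN` on an
arbitrary family, so that this file introduces no definition; the family is built inside the proof of
`eventually_not_fixed_pair_of_ne_base_pair`).  Such kernels are NORMAL.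
[cite: MochizukiSemiAnbd2006, Prop 3.6 p.38] -/
theorem levelKernel_normal (N : ℕ → Subgroup (𝒢.Gv w))
    (hN : ∀ (n : ℕ) (h : 𝒢.Gv w), h ∈ N n ↔ ∀ x : ((D.S n).SV w).obj.V, ((D.S n).SV w).obj.ρ h x = x)
    (n : ℕ) : (N n).Normal := by
  refine ⟨fun h hh f => (hN n _).2 fun x => ?_⟩
  have hh' := (hN n h).1 hh
  rw [ρ_mul_apply, ρ_mul_apply, hh', ← ρ_mul_apply, mul_inv_cancel, ρ_one_apply]

/-- Level kernels are OPEN when the level has finite fibres. [cite: MochizukiSemiAnbd2006, Prop 3.6 p.38] -/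
theorem isOpen_levelKernel (N : ℕ → Subgroup (𝒢.Gv w))
    (hN : ∀ (n : ℕ) (h : 𝒢.Gv w), h ∈ N n ↔ ∀ x : ((D.S n).SV w).obj.V, ((D.S n).SV w).obj.ρ h x = x)
    (n : ℕ) (hfin : (D.S n).IsFinite) : IsOpen (N n : Set (𝒢.Gv w)) := by
  haveI := hfin.finite_V w
  have hset : (N n : Set (𝒢.Gv w)) =
      ⋂ x : ((D.S n).SV w).obj.V,
        (Literature.AlgebraicGeometry.Frobenioids.QuasiTemperoid.stabilizerSubgroup ((D.S n).SV w) x :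
          Set (𝒢.Gv w)) := by
    ext h
    simp only [Set.mem_iInter, SetLike.mem_coe, hN,
      Literature.AlgebraicGeometry.Frobenioids.QuasiTemperoid.mem_stabilizerSubgroup_iff]
  rw [hset]
  exact isOpen_iInter_of_finite fun x =>
    Literature.AlgebraicGeometry.Frobenioids.QuasiTemperoid.isOpen_stabilizerSubgroup _ x

/-- Level kernels are ANTITONE along a fibre-surjective tower. [cite: MochizukiSemiAnbd2006, Prop 3.6 p.38] -/
theorem levelKernel_antitone (N : ℕ → Subgroup (𝒢.Gv w))
    (hN : ∀ (n : ℕ) (h : 𝒢.Gv w), h ∈ N n ↔ ∀ x : ((D.S n).SV w).obj.V, ((D.S n).SV w).obj.ρ h x = x)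
    (hsurj : ∀ n, Function.Surjective ((D.g n).fV w).hom.hom) : Antitone N := by
  refine antitone_nat_of_succ_le fun n h hh => (hN n h).2 fun x => ?_
  obtain ⟨x', rfl⟩ := hsurj n x
  rw [← CovHom.fV_ρ, (hN (n + 1) h).1 hh x']

/-- **The stabiliser of a point of `(𝒢_{∞,n})_w` lies in the level kernel**: it fixes the image point of
`(S n)_w` (equivariance of the graph-covering `𝒢_{∞,n} → S n`), hence every point of `(S n)_w` (the
endomorphisms of the Galois level act transitively on the fibre and commute with `Π_w`).
[cite: MochizukiSemiAnbd2006, Prop 3.6 p.38] -/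
theorem mem_levelKernel_of_fixes (N : ℕ → Subgroup (𝒢.Gv w))
    (hN : ∀ (n : ℕ) (h : 𝒢.Gv w), h ∈ N n ↔ ∀ x : ((D.S n).SV w).obj.V, ((D.S n).SV w).obj.ρ h x = x)
    (n : ℕ) (h : 𝒢.Gv w) (t : ((D.cover h𝒢 n).SV w).obj.V)
    (ht : ((D.cover h𝒢 n).SV w).obj.ρ h t = t) : h ∈ N n := by
  refine (hN n h).2 fun x => ?_
  -- the image point of `t` in `(S n)_w` is fixed
  set tb := (((D.S n).univCoverOverProj (Sum.inl (D.W n)) h𝒢).fV w).hom.hom t with htb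
  have htbfix : ((D.S n).SV w).obj.ρ h tb = tb := by
    rw [htb, ← CovHom.fV_ρ]
    exact congrArg _ ht
  -- any other point is a translate by an endomorphism of the Galois level
  obtain ⟨σ, hσ⟩ := D.htrans n w tb x
  rw [← hσ, ← CovHom.fV_ρ, htbfix]

/-- Conversely the level kernel fixes every point of `(𝒢_{∞,n})_w`. [cite: MochizukiSemiAnbd2006, Prop 3.6 p.38] -/
theorem fixes_of_mem_levelKernel (N : ℕ → Subgroup (𝒢.Gv w))
    (hN : ∀ (n : ℕ) (h : 𝒢.Gv w), h ∈ N n ↔ ∀ x : ((D.S n).SV w).obj.V, ((D.S n).SV w).obj.ρ h x = x)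
    (n : ℕ) (h : 𝒢.Gv w) (hh : h ∈ N n)
    (t : ((D.cover h𝒢 n).SV w).obj.V) : ((D.cover h𝒢 n).SV w).obj.ρ h t = t :=
  D.cover_ρ_eq_self_of_forall h𝒢 n h ((hN n h).1 hh) t

end GaloisLevelData

/-! ### The depth lemma at the canonical tower, distinct base branches -/

section Canonical

open CategoryTheory Topology
open scoped Pointwise
open Literature.AlgebraicGeometry.Frobenioids.QuasiTemperoid.BTempConnected (ρ_one_apply
  ρ_mul_apply ρ_inv_apply)

universe u

variable (𝒢 : ProfiniteSemiGraph.{u}) (h37 : 𝒢.Thm37Hypotheses)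

/-- **Estrangement in depth, one pair of distinct base branches.**  For the canonical tower of a `𝒢`
satisfying the hypotheses of Thm. 3.7, an element `c` of `π₁^temp(𝒢)` non-trivial at level `j₀`, a base
vertex `w` and two DISTINCT branches `b₁ ≠ b₂` of `𝔾` abutting to `w`: there is a level `k ≥ j₀` such that at
every level `k' ≥ k`, at the vertex `P.vertex k'` of ANY compatible point sequence `P` over `w`, `c` does not
fix both the edge of a tree branch over `b₁` and the edge of a tree branch over `b₂`.
[cite: MochizukiSemiAnbd2006, Thm 3.7(iii) p.41] -/
theorem eventually_not_fixed_pair_of_ne_base_pair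
    (c : (𝒢.temperedPiChart h37.toProp36Hypotheses).G) (j₀ : ℕ)
    (hc : (𝒢.galoisLevelData h37.toProp36Hypotheses).proj h37.toProp36Hypotheses.isCountable j₀ c ≠ 1)
    (w : 𝒢.graph.Vertex) {b₁ b₂ : 𝒢.graph.Branch}
    (hb₁ : 𝒢.graph.abuts b₁ = some w) (hb₂ : 𝒢.graph.abuts b₂ = some w) (hne : b₁ ≠ b₂) :
    ∃ k : ℕ, j₀ ≤ k ∧ ∀ (k' : ℕ), k ≤ k' →
      ∀ (P : (𝒢.galoisLevelData h37.toProp36Hypotheses).PointSeq h37.toProp36Hypotheses.isCountable w)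
        (β₁ β₂ : ((𝒢.galoisLevelData h37.toProp36Hypotheses).tree k').Branch),
        ((𝒢.galoisLevelData h37.toProp36Hypotheses).treeProj k').branchMap β₁ = b₁ →
        ((𝒢.galoisLevelData h37.toProp36Hypotheses).treeProj k').branchMap β₂ = b₂ →
        ((𝒢.galoisLevelData h37.toProp36Hypotheses).tree k').abuts β₁ = some (P.vertex k') →
        ((𝒢.galoisLevelData h37.toProp36Hypotheses).tree k').abuts β₂ = some (P.vertex k') →
        ((𝒢.galoisLevelData h37.toProp36Hypotheses).treeAct h37.toProp36Hypotheses.isCountable k' c).hom.edgeMap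
            (((𝒢.galoisLevelData h37.toProp36Hypotheses).tree k').edgeOf β₁) =
          ((𝒢.galoisLevelData h37.toProp36Hypotheses).tree k').edgeOf β₁ →
        ((𝒢.galoisLevelData h37.toProp36Hypotheses).treeAct h37.toProp36Hypotheses.isCountable k' c).hom.edgeMap
            (((𝒢.galoisLevelData h37.toProp36Hypotheses).tree k').edgeOf β₂) =
          ((𝒢.galoisLevelData h37.toProp36Hypotheses).tree k').edgeOf β₂ → False := by
  classical
  haveI : T1Space (𝒢.Gv w) :=
    ⟨fun x => connectedComponent_eq_singleton x ▸ isClosed_connectedComponent⟩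
  haveI : T2Space (𝒢.Gv w) := inferInstance
  -- the level kernels `N n` of `Π_w` on the finite Galois levels `(S n)_w`
  let N : ℕ → Subgroup (𝒢.Gv w) := fun n =>
    { carrier := {h | ∀ x : (((𝒢.galoisLevelData h37.toProp36Hypotheses).S n).SV w).obj.V,
        (((𝒢.galoisLevelData h37.toProp36Hypotheses).S n).SV w).obj.ρ h x = x}
      one_mem' := fun x => ρ_one_apply _ x
      mul_mem' := fun {a b} ha hb x => by rw [ρ_mul_apply, hb x, ha x]
      inv_mem' := fun {a} ha x => by
        conv_lhs => rw [← ha x]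
        exact ρ_inv_apply _ a x }
  have hN : ∀ (n : ℕ) (h : 𝒢.Gv w), h ∈ N n ↔
      ∀ x : (((𝒢.galoisLevelData h37.toProp36Hypotheses).S n).SV w).obj.V,
        (((𝒢.galoisLevelData h37.toProp36Hypotheses).S n).SV w).obj.ρ h x = x := fun n h => Iff.rfl
  have hopen : ∀ n, IsOpen (N n : Set (𝒢.Gv w)) := fun n =>
    (𝒢.galoisLevelData h37.toProp36Hypotheses).isOpen_levelKernel w N hN n
      (𝒢.galoisLevelData_isFinite h37.toProp36Hypotheses n)
  have hanti : Antitone N := (𝒢.galoisLevelData h37.toProp36Hypotheses).levelKernel_antitone w N hN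
    fun n => 𝒢.towerMap_fV_surjective h37.toProp36Hypotheses n w
  have hdir : ∀ i j, ∃ k, N k ≤ N i ∧ N k ≤ N j := fun i j =>
    ⟨max i j, hanti (le_max_left i j), hanti (le_max_right i j)⟩
  have hbot : ∀ g : 𝒢.Gv w, (∀ i, g ∈ N i) → g = 1 := fun g hg =>
    𝒢.galoisLevelData_faithfulV h37 w g fun n x => (hN n g).1 (hg n) x
  have hnormal : ∀ n, (N n).Normal := fun n =>
    (𝒢.galoisLevelData h37.toProp36Hypotheses).levelKernel_normal w N hN n
  -- the two branch subgroups and estrangement along all of `Π_w` (distinct branches)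
  let A : Set (𝒢.Gv w) := (𝒢.branchSubgroup b₁ w hb₁ : Set (𝒢.Gv w))
  let B : Set (𝒢.Gv w) := (𝒢.branchSubgroup b₂ w hb₂ : Set (𝒢.Gv w))
  have hA : IsCompact A := by
    change IsCompact ((𝒢.brHom b₁ w hb₁).toMonoidHom.range : Set (𝒢.Gv w))
    rw [MonoidHom.coe_range]
    exact isCompact_range (𝒢.brHom b₁ w hb₁).continuous
  have hB : IsCompact B := by
    change IsCompact ((𝒢.brHom b₂ w hb₂).toMonoidHom.range : Set (𝒢.Gv w))
    rw [MonoidHom.coe_range]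
    exact isCompact_range (𝒢.brHom b₂ w hb₂).continuous
  have hest : ∀ m ∈ (Set.univ : Set (𝒢.Gv w)), ∀ a ∈ A, ∀ b ∈ B, a = m * b * m⁻¹ → a = 1 :=
    Literature.GroupTheory.EstrangementDepth.conj_disjoint_of_inf_map_conj_eq_bot _ _ _
      fun m _ => (h37.isTotallyEstranged (𝒢.graph.edgeOf b₁)).2 b₁ rfl w hb₁ b₂ hb₂ m (Or.inl hne.symm)
  -- the depth level
  obtain ⟨k₁, hk₁⟩ := Literature.GroupTheory.EstrangementDepth.exists_level_mul_inter_mul_subset N hopen hdir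
    hbot isCompact_univ hA hB hest j₀
  refine ⟨max k₁ j₀, le_max_right _ _, fun k' hk' P β₁ β₂ hβ₁b hβ₂b hβ₁ hβ₂ hfix₁ hfix₂ => ?_⟩
  have hk₁k' : k₁ ≤ k' := (le_max_left _ _).trans hk'
  have hj₀k' : j₀ ≤ k' := (le_max_right _ _).trans hk'
  -- the dictionary at level `k'`
  obtain ⟨f₁, f₂, k₁', k₂', e₁, e₂, e₃⟩ :=
    P.exists_conj_brHom_pair_of_edgeMap_eq k' c b₁ b₂ hb₁ hb₂ β₁ β₂ hβ₁b hβ₂b hβ₁ hβ₂ hfix₁ hfix₂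
  set h₁ : 𝒢.Gv w := f₁ * 𝒢.brHom b₁ w hb₁ k₁' * f₁⁻¹ with hh₁
  set h₂ : 𝒢.Gv w := f₂ * 𝒢.brHom b₂ w hb₂ k₂' * f₂⁻¹ with hh₂
  -- `h₁⁻¹ h₂` is in the level kernel `N k'`
  have hNk : h₁⁻¹ * h₂ ∈ N k' :=
    (𝒢.galoisLevelData h37.toProp36Hypotheses).mem_levelKernel_of_fixes h37.toProp36Hypotheses.isCountable w
      N hN k' _ (P.pt k') e₃
  -- `y := f₁⁻¹ h₁ f₁ ∈ A·N ∩ (m B m⁻¹)·N` with `m := f₁⁻¹ f₂`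
  set y : 𝒢.Gv w := f₁⁻¹ * h₁ * f₁ with hy
  have hyA : y ∈ A * (N k' : Set (𝒢.Gv w)) := by
    refine Set.mem_mul.mpr ⟨𝒢.brHom b₁ w hb₁ k₁', ⟨k₁', rfl⟩, 1, (N k').one_mem, ?_⟩
    rw [hy, hh₁]; group
  have hyB : y ∈ ((fun b => (f₁⁻¹ * f₂) * b * (f₁⁻¹ * f₂)⁻¹) '' B) * (N k' : Set (𝒢.Gv w)) := by
    refine Set.mem_mul.mpr ⟨(f₁⁻¹ * f₂) * 𝒢.brHom b₂ w hb₂ k₂' * (f₁⁻¹ * f₂)⁻¹,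
      ⟨𝒢.brHom b₂ w hb₂ k₂', ⟨k₂', rfl⟩, rfl⟩, f₁⁻¹ * (h₁⁻¹ * h₂)⁻¹ * f₁⁻¹⁻¹, ?_, ?_⟩
    · exact (hnormal k').conj_mem _ ((N k').inv_mem hNk) f₁⁻¹
    · rw [hy, hh₁, hh₂]; group
  -- depth: `y ∈ N j₀`, hence `h₁ ∈ N j₀`
  have hyN : y ∈ (N j₀ : Set (𝒢.Gv w)) := hk₁ k' (hanti hk₁k') (f₁⁻¹ * f₂) (Set.mem_univ _) y hyA hyB
  have hh₁N : h₁ ∈ N j₀ := by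
    have h := (hnormal j₀).conj_mem _ hyN f₁
    have hcalc : f₁ * y * f₁⁻¹ = h₁ := by rw [hy]; group
    rwa [hcalc] at h
  -- hence `σ_{j₀}^{h₁} = 1` and `ρ_{j₀}(c) = 1`
  have hgal : P.gal j₀ h₁ = 1 :=
    (P.gal_eq_one_iff j₀ h₁).mpr ((𝒢.galoisLevelData h37.toProp36Hypotheses).fixes_of_mem_levelKernel
      h37.toProp36Hypotheses.isCountable w N hN j₀ h₁ hh₁N (P.pt j₀))
  have hproj : (𝒢.galoisLevelData h37.toProp36Hypotheses).proj h37.toProp36Hypotheses.isCountable j₀ c =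
      P.gal j₀ h₁ := by
    rw [← (𝒢.galoisLevelData h37.toProp36Hypotheses).mapLE_proj h37.toProp36Hypotheses.isCountable hj₀k' c, e₁]
    exact (𝒢.galoisLevelData h37.toProp36Hypotheses).mapLE_of_step h37.toProp36Hypotheses.isCountable
      (fun n => P.gal n h₁) (fun n => P.step_gal n h₁) hj₀k'
  exact hc (hproj.trans hgal)

/-- **Estrangement in depth at a vertex of finite valence, distinct base branches** (the half B1b(i) of
the local level-estrangement binder (LE_C,w)): for `c ≠ 1` at level `j₀` and `w` with finitely many branches,
ONE level `k` works for all pairs of distinct base branches at `w` and all tree vertices over `w`.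
[cite: MochizukiSemiAnbd2006, Thm 3.7(iii) p.41] -/
theorem eventually_not_fixed_pair_of_ne_base
    (c : (𝒢.temperedPiChart h37.toProp36Hypotheses).G) (j₀ : ℕ)
    (hc : (𝒢.galoisLevelData h37.toProp36Hypotheses).proj h37.toProp36Hypotheses.isCountable j₀ c ≠ 1)
    (w : 𝒢.graph.Vertex) (hw : Set.Finite {b : 𝒢.graph.Branch | 𝒢.graph.abuts b = some w}) :
    ∃ k : ℕ, j₀ ≤ k ∧ ∀ (k' : ℕ), k ≤ k' →
      ∀ (v : ((𝒢.galoisLevelData h37.toProp36Hypotheses).tree k').Vertex),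
        ((𝒢.galoisLevelData h37.toProp36Hypotheses).treeProj k').vertexMap v = w →
      ∀ (β₁ β₂ : ((𝒢.galoisLevelData h37.toProp36Hypotheses).tree k').Branch),
        ((𝒢.galoisLevelData h37.toProp36Hypotheses).treeProj k').branchMap β₁ ≠
          ((𝒢.galoisLevelData h37.toProp36Hypotheses).treeProj k').branchMap β₂ →
        ((𝒢.galoisLevelData h37.toProp36Hypotheses).tree k').abuts β₁ = some v →
        ((𝒢.galoisLevelData h37.toProp36Hypotheses).tree k').abuts β₂ = some v →
        ((𝒢.galoisLevelData h37.toProp36Hypotheses).treeAct h37.toProp36Hypotheses.isCountable k' c).hom.edgeMap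
            (((𝒢.galoisLevelData h37.toProp36Hypotheses).tree k').edgeOf β₁) =
          ((𝒢.galoisLevelData h37.toProp36Hypotheses).tree k').edgeOf β₁ →
        ((𝒢.galoisLevelData h37.toProp36Hypotheses).treeAct h37.toProp36Hypotheses.isCountable k' c).hom.edgeMap
            (((𝒢.galoisLevelData h37.toProp36Hypotheses).tree k').edgeOf β₂) =
          ((𝒢.galoisLevelData h37.toProp36Hypotheses).tree k').edgeOf β₂ → False := by
  classical
  -- the finitely many ordered pairs of distinct branches at `w`
  let Pairs := {p : 𝒢.graph.Branch × 𝒢.graph.Branch //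
    𝒢.graph.abuts p.1 = some w ∧ 𝒢.graph.abuts p.2 = some w ∧ p.1 ≠ p.2}
  haveI : Finite Pairs := by
    haveI : Finite {b : 𝒢.graph.Branch | 𝒢.graph.abuts b = some w} := hw.to_subtype
    refine Finite.of_injective
      (fun p : Pairs => ((⟨p.1.1, p.2.1⟩ : {b : 𝒢.graph.Branch | 𝒢.graph.abuts b = some w}),
        (⟨p.1.2, p.2.2.1⟩ : {b : 𝒢.graph.Branch | 𝒢.graph.abuts b = some w}))) ?_
    rintro ⟨⟨a, b⟩, ha⟩ ⟨⟨a', b'⟩, ha'⟩ h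
    simp only [Prod.mk.injEq, Subtype.mk.injEq] at h
    obtain ⟨rfl, rfl⟩ := h
    rfl
  have hk := fun p : Pairs =>
    𝒢.eventually_not_fixed_pair_of_ne_base_pair h37 c j₀ hc w p.2.1 p.2.2.1 p.2.2.2
  choose kf hkf using hk
  obtain ⟨K, hK⟩ := (Set.finite_range kf).bddAbove
  refine ⟨max K j₀, le_max_right _ _, fun k' hk' v hv β₁ β₂ hne hβ₁ hβ₂ hfix₁ hfix₂ => ?_⟩
  -- the base branches abut to `w`
  have hb₁ : 𝒢.graph.abuts (((𝒢.galoisLevelData h37.toProp36Hypotheses).treeProj k').branchMap β₁) = some w := by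
    rw [((𝒢.galoisLevelData h37.toProp36Hypotheses).treeProj k').abuts_branchMap β₁ v hβ₁, hv]
  have hb₂ : 𝒢.graph.abuts (((𝒢.galoisLevelData h37.toProp36Hypotheses).treeProj k').branchMap β₂) = some w := by
    rw [((𝒢.galoisLevelData h37.toProp36Hypotheses).treeProj k').abuts_branchMap β₂ v hβ₂, hv]
  -- a point sequence over `w` through `v`
  obtain ⟨P, hPv⟩ : ∃ P : (𝒢.galoisLevelData h37.toProp36Hypotheses).PointSeq h37.toProp36Hypotheses.isCountable w,
      P.vertex k' = v := by
    subst hv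
    exact exists_pointSeq_vertex_eq_galoisLevelData h37.toProp36Hypotheses k' v
  rw [← hPv] at hβ₁ hβ₂
  let p : Pairs := ⟨(_, _), hb₁, hb₂, hne⟩
  have hkle : kf p ≤ k' := ((hK ⟨p, rfl⟩).trans (le_max_left _ _)).trans hk'
  exact (hkf p).2 k' hkle P β₁ β₂ rfl rfl hβ₁ hβ₂ hfix₁ hfix₂

end Canonical

end ProfiniteSemiGraph

end Literature.AnabelianGeometry.SemiGraphs
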